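import Summits.CriticalPhenomena.PercolationContinuityZ3.Theorems.Transplant.AutChartTreeChartFrames
import Summits.CriticalPhenomena.PercolationContinuityZ3.Theorems.Transplant.AutEndStateKernel
import Summits.CriticalPhenomena.PercolationContinuityZ3.Theorems.Transplant.SkelPhiQStepsNMaps
import HarnessLib

/-!
# The TREE CHART of an action with finitely many orbits, IV: FATTENED CYLINDER REACHABILITY (κ″) for the coarse tree chart — kernel walks, small
# movers, and the route `u → (quasi-steps inside the box) → (tree walk) → (small mover + kernel walk) → v`

builds on p205010 (kernel theorem, internal audit signed; external expert review pending) — nothing in this file uses p205010 and nothing here is a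
percolation statement or a claim about any node.  Lane `prim-bschramm`, seat `prim-bschramm-p5` gen 28 (refuter / sharpness seat; adapter lemma (L2)
of the lane INBOX 2026-08-27 06:43Z / 06:48Z).  Helper file (`--supports stmt-CriticalPhenomena-4575 --as helper`); PROOFS ONLY (def-free).

WHY.  The design owner's quasi-step carrier «PlanarSkeletonFrmQuasiDefs» (staged 2026-08-27) replaces (κ′) 'cylinders connected' by (κ″) `cyl_reach`:
any two vertices of the cylinder of half-width `ℓ ≥ ℓ₀` at a base vertex are joined INSIDE the cylinder of half-width `ℓ + W`.  For the coarse tree chart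
`D.coarse` of «AutChartTreeChart» this holds — with ANY `ℓ₀` (even `0`) and an explicit `W` — as soon as the kernel of the character is generated by
BOUNDED movers at every representative (Milnor's lemma off exponential growth, «AutEndStateKernel»):
* §1 `chart_walk_bound`, `exists_walk_smul_bound`, `abs_ediv_sub_ediv_le_of_le_mul` (bookkeeping: fine excursion along walks, translation, coarse-graining);
* §2 **`ker_walk`**: a kernel element `k` moves a representative `r` along a walk whose FINE chart stays in the box of radius `R m` (closure induction over the
  bounded kernel movers — kernel translates do not move the chart); `exists_ker_gen` (the hypothesis, off exponential growth, uniformly in `r`);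
* §3 **`exists_small_movers`**: uniformly in `r ∈ reps` and in the value `y` with `‖y‖_∞ ≤ N`, an element of value `y` moving `r` along a chart-bounded walk;
* §4 **`coarse_cyl_reach`**: `∃ W, ∀ t ℓ u v`, `u, v ∈ cyl t ℓ ⇒` joined inside `cyl t (ℓ + W)` (as `Reachable` of the induced graph) — the (κ″) field.
[cite: MilnorSolvableGrowth1968, Lemma 1] [cite: KozmaNitzan2024, §4 p. 15 (boxes), p. 16 (Lemma 8)] [cite: BenjaminiSchramm1996, §2 (almost transitive graphs)]
-/

noncomputable section

namespace Summit.CriticalPhenomena.PercolationContinuityZ3.Theorems.Transplant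

open SimpleGraph Literature.Barriers.CriticalPhenomena Literature.Probability.LatticeModels Literature.Probability.Percolation
open scoped Classical

namespace AutChart

namespace TreeDatum

variable {V : Type} {G : SimpleGraph V} {A : Type} [Group A] [MulAction A V] (D : TreeDatum G A)

/-! ## §1 Bookkeeping: fine excursion along walks, translation, coarse-graining -/

/-- **Along a walk of length `ℓ` the fine chart moves by at most `R ℓ`** per coordinate. [folklore] -/
theorem chart_walk_bound [G.LocallyFinite] :
    ∀ {u v : V} (w : G.Walk u v), ∀ z ∈ w.support, ∀ j : Fin 2, |D.chart z j - D.chart u j| ≤ (D.R : ℤ) * w.length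
  | _, _, Walk.nil => by
    intro z hz j
    rw [Walk.support_nil, List.mem_singleton] at hz
    subst hz
    simp
  | u, _, Walk.cons (v := u') h w => by
    intro z hz j
    rw [Walk.support_cons, List.mem_cons] at hz
    rw [Walk.length_cons]
    rcases hz with rfl | hz
    · simp
    · have ih := chart_walk_bound w z hz j
      have hl := D.fine_lip h j
      rw [abs_le] at ih hl ⊢
      push_cast at ih ⊢
      constructor <;> nlinarith

/-- **Translating a chart-bounded walk** by `a` shifts the reference value by `c a`. [folklore] -/
theorem exists_walk_smul_bound (a : A) {u v : V} {x₀ : Site 2} {E : ℤ}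
    (h : ∃ w : G.Walk u v, ∀ z ∈ w.support, ∀ j : Fin 2, |D.chart z j - x₀ j| ≤ E) :
    ∃ w : G.Walk (a • u) (a • v), ∀ z ∈ w.support, ∀ j : Fin 2, |D.chart z j - (Multiplicative.toAdd (D.c a) j + x₀ j)| ≤ E := by
  obtain ⟨w, hw⟩ := h
  refine ⟨(w.map (smulIso D.act a).toHom).copy rfl rfl, fun z hz j => ?_⟩
  rw [Walk.support_copy] at hz
  obtain ⟨z₀, hz₀, rfl⟩ := exists_mem_support_of_map_smul D.act a w hz
  rw [D.chart_smul, Pi.add_apply]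
  have e : Multiplicative.toAdd (D.c a) j + D.chart z₀ j - (Multiplicative.toAdd (D.c a) j + x₀ j) = D.chart z₀ j - x₀ j := by ring
  rw [e]
  exact hw z₀ hz₀ j

/-- `|x − y| ≤ N W ⟹ |x/N − y/N| ≤ W` (`N > 0`, Euclidean quotient). [folklore] -/
theorem abs_ediv_sub_ediv_le_of_le_mul {N : ℤ} (hN : 0 < N) {x y : ℤ} {W : ℕ} (h : |x - y| ≤ N * W) : |x / N - y / N| ≤ W := by
  rw [abs_le] at h ⊢
  obtain ⟨h1, h2⟩ := h
  have hx1 : x / N ≤ (y + N * W) / N := Int.ediv_le_ediv hN (by linarith)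
  have hx2 : (y + N * (-(W : ℤ))) / N ≤ x / N := Int.ediv_le_ediv hN (by linarith)
  rw [Int.add_mul_ediv_left _ _ hN.ne'] at hx1 hx2
  constructor <;> linarith

/-- Equal Euclidean quotients ⟹ the arguments differ by less than `N`. [folklore] -/
theorem abs_sub_le_of_ediv_eq {N : ℤ} (hN : 0 < N) {x y : ℤ} (h : x / N = y / N) : |x - y| ≤ N := by
  have hx := Int.emod_add_mul_ediv x N
  have hy := Int.emod_add_mul_ediv y N
  have hx0 := Int.emod_nonneg x hN.ne'
  have hy0 := Int.emod_nonneg y hN.ne'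
  have hx1 := Int.emod_lt_of_pos x hN
  have hy1 := Int.emod_lt_of_pos y hN
  rw [h] at hx
  rw [abs_le]
  generalize x % N = rx at hx hx0 hx1
  generalize y % N = ry at hy hy0 hy1
  generalize y / N = q at hx hy
  constructor <;> nlinarith

/-! ## §2 Kernel walks -/

/-- **KERNEL WALKS**: if `ker c` is generated by kernel elements moving the representative `r` by at most `m`, then every kernel element `k` moves `r`
along a walk whose FINE chart stays in the box of radius `R m` (closure induction; kernel translates do not move the chart).
[cite: MilnorSolvableGrowth1968, Lemma 1] -/
theorem ker_walk [G.LocallyFinite] {r : V} (hr : r ∈ D.reps) {m : ℕ}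
    (hker : ∀ k : A, D.c k = 1 → k ∈ Subgroup.closure {g : A | D.c g = 1 ∧ g • r ∈ graphBall G r m}) {k : A} (hk : D.c k = 1) :
    ∃ w : G.Walk r (k • r), ∀ z ∈ w.support, ∀ j : Fin 2, |D.chart z j| ≤ (D.R : ℤ) * m := by
  have hmem := hker k hk
  suffices H : D.c k = 1 ∧ ∃ w : G.Walk r (k • r), ∀ z ∈ w.support, ∀ j : Fin 2, |D.chart z j - (0 : Site 2) j| ≤ (D.R : ℤ) * m by
    obtain ⟨w, hw⟩ := H.2
    exact ⟨w, fun z hz j => by have h := hw z hz j; rwa [Pi.zero_apply, sub_zero] at h⟩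
  clear hk
  induction hmem using Subgroup.closure_induction with
  | mem g hg =>
    refine ⟨hg.1, ?_⟩
    obtain ⟨w, hw⟩ := hg.2
    refine ⟨w, fun z hz j => ?_⟩
    have h := D.chart_walk_bound w z hz j
    rw [D.chart_of_mem hr] at h
    rw [Pi.zero_apply]
    exact h.trans (by exact_mod_cast Nat.mul_le_mul_left _ hw)
  | one =>
    refine ⟨map_one _, (Walk.nil : G.Walk r r).copy rfl (one_smul A r).symm, fun z hz j => ?_⟩
    rw [Walk.support_copy, Walk.support_nil, List.mem_singleton] at hz
    subst hz
    rw [D.chart_of_mem hr, Pi.zero_apply, sub_zero, abs_zero]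
    positivity
  | mul x y _ _ hx hy =>
    obtain ⟨hx1, wx, hwx⟩ := hx
    obtain ⟨hy1, hwy⟩ := hy
    refine ⟨by rw [map_mul, hx1, hy1, one_mul], ?_⟩
    obtain ⟨wy', hwy'⟩ := D.exists_walk_smul_bound x hwy
    refine ⟨(wx.append wy').copy rfl (mul_smul x y r).symm, fun z hz j => ?_⟩
    rw [Walk.support_copy, Walk.support_append, List.mem_append] at hz
    rcases hz with hz | hz
    · exact hwx z hz j
    · have h := hwy' z (List.mem_of_mem_tail hz) j
      rwa [hx1, toAdd_one, Pi.zero_apply, zero_add] at h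
  | inv x _ hx =>
    obtain ⟨hx1, hwx⟩ := hx
    refine ⟨by rw [map_inv, hx1, inv_one], ?_⟩
    obtain ⟨w', hw'⟩ := D.exists_walk_smul_bound x⁻¹ hwx
    refine ⟨w'.reverse.copy (inv_smul_smul x r) rfl, fun z hz j => ?_⟩
    rw [Walk.support_copy, Walk.support_reverse, List.mem_reverse] at hz
    have h := hw' z hz j
    rwa [map_inv, hx1, inv_one, toAdd_one, Pi.zero_apply, zero_add] at h

/-- **The kernel hypothesis holds off exponential growth**, uniformly over the representatives («AutEndStateKernel» `ker_eq_closure_bounded` at each base,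
radius = the maximum). [cite: MilnorSolvableGrowth1968, Lemma 1 pp. 447–448] -/
theorem exists_ker_gen [G.LocallyFinite] (hc : G.Connected) (hG : ¬ HasExponentialGrowth G) :
    ∃ m : ℕ, ∀ r ∈ D.reps, ∀ k : A, D.c k = 1 → k ∈ Subgroup.closure {g : A | D.c g = 1 ∧ g • r ∈ graphBall G r m} := by
  have h : ∀ r : V, ∃ M : ℕ, D.c.ker = Subgroup.closure {g | g ∈ D.c.ker ∧ g • r ∈ graphBall G r M} := fun r =>
    EndStateKernel.ker_eq_closure_bounded D.act hc r D.reps D.cover hG D.c (fun h hh => D.stab r h hh)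
  choose M hM using h
  refine ⟨D.reps.sup M, fun r hr k hk => ?_⟩
  have hk' : k ∈ D.c.ker := (MonoidHom.mem_ker).2 hk
  rw [hM r] at hk'
  refine Subgroup.closure_mono (fun g hg => ?_) hk'
  exact ⟨(MonoidHom.mem_ker).1 hg.1, graphBall_mono G r (Finset.le_sup (f := M) hr) hg.2⟩

/-! ## §3 Small movers -/

/-- **SMALL MOVERS**: there is `E` such that for every representative `r` and every element `a` of sup-norm value `≤ N` some element of the SAME value moves
`r` along a walk whose fine chart stays in the box of radius `E` (finitely many values, any walks by connectedness). [folklore] -/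
theorem exists_small_movers [G.LocallyFinite] (hc : G.Connected) :
    ∃ E : ℕ, ∀ r ∈ D.reps, ∀ a : A, (∀ j : Fin 2, |Multiplicative.toAdd (D.c a) j| ≤ D.N) →
      ∃ b : A, D.c b = D.c a ∧ ∃ w : G.Walk r (b • r), ∀ z ∈ w.support, ∀ j : Fin 2, |D.chart z j| ≤ E := by
  have hw : ∀ (r : V) (a : A), ∃ n : ℕ, ∃ w : G.Walk r (a • r), w.length ≤ n := fun r a => by
    obtain ⟨w⟩ := hc.preconnected r (a • r)
    exact ⟨w.length, w, le_rfl⟩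
  choose len wlk hwlk using hw
  let pick : Site 2 → A := fun y => if h : ∃ a : A, Multiplicative.toAdd (D.c a) = y then Classical.choose h else 1
  refine ⟨D.R * (D.reps.sup fun r => (box 2 D.N).sup fun y => len r (pick y)), fun r hr a ha => ?_⟩
  set y : Site 2 := Multiplicative.toAdd (D.c a) with hy
  have hyY : y ∈ box 2 D.N := by rw [mem_box]; intro j; exact abs_le.1 (ha j)
  have hex : ∃ a' : A, Multiplicative.toAdd (D.c a') = y := ⟨a, rfl⟩
  have hpick : Multiplicative.toAdd (D.c (pick y)) = y := by
    simp only [pick, dif_pos hex]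
    exact Classical.choose_spec hex
  refine ⟨pick y, Multiplicative.toAdd.injective (by rw [hpick]), wlk r (pick y), fun z hz j => ?_⟩
  have h := D.chart_walk_bound (wlk r (pick y)) z hz j
  rw [D.chart_of_mem hr, Pi.zero_apply, sub_zero] at h
  refine h.trans ?_
  have h1 : len r (pick y) ≤ D.reps.sup fun r => (box 2 D.N).sup fun y => len r (pick y) :=
    le_trans (Finset.le_sup (f := fun y => len r (pick y)) hyY) (Finset.le_sup (f := fun r => (box 2 D.N).sup fun y => len r (pick y)) hr)
  exact_mod_cast Nat.mul_le_mul_left D.R ((hwlk r (pick y)).trans h1)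

/-! ## §4 Fattened cylinder reachability (κ″) -/

/-- **(κ″) FOR THE COARSE TREE CHART**: if the kernel is generated by bounded movers at every representative, there is `W` such that, for every centre `t`,
every half-width `ℓ` and all `u, v` with `coarse u − coarse t, coarse v − coarse t ∈ box ℓ`, the vertices `u`, `v` are joined INSIDE
`{w | coarse w − coarse t ∈ box (ℓ + W)}`.  Route: exact-footprint quasi-steps from `u` to a vertex `w₁` at the coarse value of `v` (track in the hull widened by
one), the translated tree walk to the type of `v` (fine chart constant), then a small mover and a kernel walk (fine excursion `≤ E + R m + N`).
[cite: KozmaNitzan2024, §4 p. 15 (boxes), p. 19 (Step III)] [cite: MilnorSolvableGrowth1968, Lemma 1] -/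
theorem coarse_cyl_reach [G.LocallyFinite] (hc : G.Connected) {m : ℕ}
    (hker : ∀ r ∈ D.reps, ∀ k : A, D.c k = 1 → k ∈ Subgroup.closure {g : A | D.c g = 1 ∧ g • r ∈ graphBall G r m}) :
    ∃ W : ℕ, ∀ (t : V) (ℓ : ℕ) (u v : V), D.coarse u - D.coarse t ∈ box 2 ℓ → D.coarse v - D.coarse t ∈ box 2 ℓ →
      ∃ (hu : u ∈ {w | D.coarse w - D.coarse t ∈ box 2 (ℓ + W)}) (hv : v ∈ {w | D.coarse w - D.coarse t ∈ box 2 (ℓ + W)}),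
        (G.induce {w | D.coarse w - D.coarse t ∈ box 2 (ℓ + W)}).Reachable ⟨u, hu⟩ ⟨v, hv⟩ := by
  obtain ⟨E, hE⟩ := D.exists_small_movers hc
  have hN := D.N_pos
  -- the fine excursion of the last leg and the fattening
  set B : ℕ := E + D.R * m + D.N with hB
  refine ⟨B + 1, fun t ℓ u v hu hv => ?_⟩
  set S : Set V := {w | D.coarse w - D.coarse t ∈ box 2 (ℓ + (B + 1))} with hS
  rw [mem_box] at hu hv
  -- Step 0: quasi-steps from `u` to a vertex at the coarse value of `v`, track in the hull widened by one
  obtain ⟨w₁, hw₁, p₀, -, htr₀⟩ := (Skelφ.psiSteps_of_qStepsN D.coarse_qStepsN).exists_walk_eq u (D.coarse v)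
  have hS₀ : ∀ z ∈ p₀.support, z ∈ S := fun z hz => by
    show D.coarse z - D.coarse t ∈ box 2 (ℓ + (B + 1))
    rw [mem_box]
    intro j
    obtain ⟨h1, h2⟩ := htr₀ z hz j
    obtain ⟨hu1, hu2⟩ := hu j
    obtain ⟨hv1, hv2⟩ := hv j
    rw [Pi.sub_apply] at hu1 hu2 hv1 hv2 ⊢
    push_cast
    constructor
    · have := min_le_iff.1 (le_refl (min (D.coarse u j) (D.coarse v j))); omega
    · have := le_max_iff.1 (le_refl (max (D.coarse u j) (D.coarse v j))); omega
  -- Step A: the types of `w₁` and `v`; the tree walk from `w₁` to the type of `v`, translated by `osec w₁`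
  obtain ⟨a', r', hr', hw₁eq⟩ := D.cover w₁
  obtain ⟨b, r, hr, hveq⟩ := D.cover v
  obtain ⟨q, -, hq⟩ := D.exists_repPath hr' hr
  have hcw₁ : D.chart w₁ = Multiplicative.toAdd (D.c a') := by rw [← hw₁eq, D.chart_smul, D.chart_of_mem hr', add_zero]
  have hcv : D.chart v = Multiplicative.toAdd (D.c b) := by rw [← hveq, D.chart_smul, D.chart_of_mem hr, add_zero]
  have hA : ∃ w : G.Walk w₁ (a' • r), ∀ z ∈ w.support, ∀ j : Fin 2, |D.chart z j - (Multiplicative.toAdd (D.c a') j + (0 : Site 2) j)| ≤ (B : ℤ) := by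
    have h0 : ∃ w : G.Walk r' r, ∀ z ∈ w.support, ∀ j : Fin 2, |D.chart z j - (0 : Site 2) j| ≤ (B : ℤ) :=
      ⟨q, fun z hz j => by rw [D.chart_of_mem (hq z hz), Pi.zero_apply, sub_zero, abs_zero]; positivity⟩
    obtain ⟨w, hw⟩ := D.exists_walk_smul_bound a' h0
    exact ⟨w.copy hw₁eq rfl, fun z hz j => hw z (by rwa [Walk.support_copy] at hz) j⟩
  -- Step B: the value gap is smaller than `N`; a small mover of that value and a kernel walk
  have hgap : ∀ j : Fin 2, |Multiplicative.toAdd (D.c (a'⁻¹ * b)) j| ≤ D.N := fun j => by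
    rw [map_mul, map_inv, toAdd_mul, toAdd_inv, Pi.add_apply, Pi.neg_apply]
    have hq : D.chart v j / (D.N : ℤ) = D.chart w₁ j / (D.N : ℤ) := by
      have h := congrFun hw₁ j
      rw [D.coarse_apply, D.coarse_apply] at h
      exact h.symm
    rw [hcv, hcw₁] at hq
    have h := abs_sub_le_of_ediv_eq hN hq
    rwa [← neg_add_eq_sub] at h
  obtain ⟨b', hb', q₁, hq₁⟩ := hE r hr (a'⁻¹ * b) hgap
  set k : A := b'⁻¹ * (a'⁻¹ * b) with hk
  have hk1 : D.c k = 1 := by rw [hk, map_mul, map_inv, hb', inv_mul_cancel]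
  obtain ⟨q₂, hq₂⟩ := D.ker_walk hr (hker r hr) hk1
  -- translate the kernel walk by `b'`: from `b' • r` to `(a'⁻¹ * b) • r`
  have hB2 : ∃ w : G.Walk (b' • r) ((a'⁻¹ * b) • r), ∀ z ∈ w.support, ∀ j : Fin 2, |D.chart z j| ≤ (B : ℤ) := by
    have h0 : ∃ w : G.Walk r (k • r), ∀ z ∈ w.support, ∀ j : Fin 2, |D.chart z j - (0 : Site 2) j| ≤ (D.R : ℤ) * m :=
      ⟨q₂, fun z hz j => by rw [Pi.zero_apply, sub_zero]; exact hq₂ z hz j⟩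
    obtain ⟨w, hw⟩ := D.exists_walk_smul_bound b' h0
    have e : b' • k • r = (a'⁻¹ * b) • r := by rw [← mul_smul, hk, mul_inv_cancel_left]
    refine ⟨w.copy rfl e, fun z hz j => ?_⟩
    rw [Walk.support_copy] at hz
    have h := hw z hz j
    have hval : |Multiplicative.toAdd (D.c b') j| ≤ D.N := by rw [hb']; exact hgap j
    rw [Pi.zero_apply, add_zero, abs_le] at h
    rw [abs_le] at hval ⊢
    have hRm : (0 : ℤ) ≤ D.R * m := by positivity
    constructor <;> nlinarith [h.1, h.2, hval.1, hval.2]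
  -- Step B assembled at the representative: `r → b' • r → (a'⁻¹ b) • r`, then translated by `a'` to `a' • r → v`
  have hB3 : ∃ w : G.Walk r ((a'⁻¹ * b) • r), ∀ z ∈ w.support, ∀ j : Fin 2, |D.chart z j - (0 : Site 2) j| ≤ (B : ℤ) := by
    obtain ⟨w, hw⟩ := hB2
    refine ⟨q₁.append w, fun z hz j => ?_⟩
    rw [Pi.zero_apply, sub_zero]
    rw [Walk.support_append, List.mem_append] at hz
    rcases hz with hz | hz
    · refine (hq₁ z hz j).trans ?_
      have : (0:ℤ) ≤ D.R * m := by positivity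
      have : (0 : ℤ) ≤ D.N := hN.le
      linarith
    · exact hw z (List.mem_of_mem_tail hz) j
  obtain ⟨p₂, hp₂⟩ := D.exists_walk_smul_bound a' hB3
  have e₂ : a' • (a'⁻¹ * b) • r = v := by rw [← mul_smul, mul_inv_cancel_left, hveq]
  obtain ⟨p₁, hp₁⟩ := hA
  -- the legs after `w₁` stay within fine distance `B` of `chart w₁`, hence within coarse distance `B` of `coarse w₁`
  have hSB : ∀ z : V, (∀ j : Fin 2, |D.chart z j - (Multiplicative.toAdd (D.c a') j + (0 : Site 2) j)| ≤ (B : ℤ)) → z ∈ S := by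
    intro z hz
    show D.coarse z - D.coarse t ∈ box 2 (ℓ + (B + 1))
    rw [mem_box]
    intro j
    have h1 : |D.chart z j - D.chart w₁ j| ≤ (D.N : ℤ) * B := by
      have h := hz j
      rw [Pi.zero_apply, add_zero, ← hcw₁] at h
      refine h.trans ?_
      have : (1 : ℤ) ≤ D.N := by exact_mod_cast (show 1 ≤ D.N by have := D.N_pos; exact_mod_cast this)
      have : (0 : ℤ) ≤ B := by positivity
      nlinarith
    have h2 := abs_ediv_sub_ediv_le_of_le_mul hN h1
    rw [← D.coarse_apply, ← D.coarse_apply, abs_le] at h2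
    have h3 : D.coarse w₁ j = D.coarse v j := congrFun hw₁ j
    obtain ⟨hv1, hv2⟩ := hv j
    rw [Pi.sub_apply] at hv1 hv2 ⊢
    push_cast
    constructor <;> omega
  -- the full route and its induced walk
  let P : G.Walk u v := p₀.append (p₁.append (p₂.copy rfl e₂))
  have hP : ∀ z ∈ P.support, z ∈ S := by
    intro z hz
    rw [Walk.support_append, List.mem_append] at hz
    rcases hz with hz | hz
    · exact hS₀ z hz
    · have hz' := List.mem_of_mem_tail hz
      rw [Walk.support_append, List.mem_append] at hz'
      rcases hz' with hz' | hz'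
      · exact hSB z (hp₁ z hz')
      · have hz'' := List.mem_of_mem_tail hz'
        rw [Walk.support_copy] at hz''
        exact hSB z (hp₂ z hz'')
  exact ⟨hP u P.start_mem_support, hP v P.end_mem_support, ⟨P.induce S hP⟩⟩

end TreeDatum

end AutChart

end Summit.CriticalPhenomena.PercolationContinuityZ3.Theorems.Transplant

end
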